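import Summits.ValiantsHypothesis.ValiantsHypothesis.Theorems.KPlusLogSqLawTropicalOrbitDominance

/-!
# Tropical census, symmetric designs — the GENERAL two-point ORBIT EXCHANGE lemma, and rules R1w / R1′w as its instances

HONEST FRAMING.  Helper file (seat typer (g11), cell `pub-symmetroid`, 2026-08-27; `--supports` the `WeakLifting` item
stmt-ValiantsHypothesis-19561 as a helper, no closure claim; desk R1631: «orbit rules R1′w…R3′w remain theory g24 / typer's»).  Pure
lemma file in the transpose-ORBIT carrier model of `…KPlusLogSqLawTropicalOrbitDominance` (theory g23 / typer g10, p473280): general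
format `(m, K)`, integer slopes, no sweep object, no strictness, no adjacency.  Nothing here is a census numeral: single-term / orbit
tropical objects bound no real pencil; ζ_sym(3,4) ∈ {18,19}, the kernel single-term `(3,4)` window `[15, 18]`, DoorA34 =
`PosRootLawAt 3 4 18` (stmt-ValiantsHypothesis-19980) and DoorA26 (stmt-19979) are untouched (OPEN, typed, never asserted); nothing on
`TropicalB` / `WeakLifting` as closed, on `MatrixDescartes` (stmt-ValiantsHypothesis-18050) or on `VP ≠ VNP`.

THE LEMMA (`orbit_exchange`).  Let `P` be orbit-dominant at `θ₁` and `Q` orbit-dominant at `θ₂ > θ₁` (same design), and let `H₁`, `H₂`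
be two PRESENT terms («hybrids») with `H₁ ∉ {P, Pᵀ}`, `H₂ ∉ {Q, Qᵀ}` whose letters RE-PAIR those of `P` and `Q`: the exponent sums and
the height sums agree, `e(P) + e(Q) = e(H₁) + e(H₂)` and `h(P) + h(Q) = h(H₁) + h(H₂)` (so `W(P) + W(Q) = W(H₁) + W(H₂)` identically in
`θ`).  Then `W(P)(θ₁) > W(H₁)(θ₁)` and `W(Q)(θ₂) > W(H₂)(θ₂)` make the affine function `W(P) − W(H₁) = W(H₂) − W(Q)` positive at `θ₁` and
negative at `θ₂`, hence of negative slope: **`e(P) < e(H₁)`** (equivalently `e(H₂) < e(Q)`, `orbit_exchange_right`).  This is the common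
core of all eight pairwise rules of the method memo `HOME/theory/g23/method/TSYM34-METHOD-g23.md` §3 (M, R1w, R1′w, R2w, R2′w, R3w,
R3′w; S is the tree's `slope_lt_of_dominant`): each is ONE application with a named hybrid pair plus two `Finset.sum` bookkeeping
identities.  Instances here: the D/T hybrid bookkeeping (`sum_d_hybrid_DT`, `sum_v_hybrid_DT`), **`rule_R1w'`** (R1′w: transposition orbit
at `θ₁`, identity orbit at `θ₂` ⇒ `d(μ i) + d(μ j) < d(λ i) + d(λ j)` in sum form) and `rule_R1w_of_exchange` (p473280's `rule_R1w`
re-derived, as a consistency check).  The `m = 3` rules with pair carriers (R2w, R2′w, R3w, R3′w: three comparisons each) are left to a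
file in `m = 3` letter coordinates once the joint port plan (P′) fixes their shape.  [folklore] (linear exchange argument).
APPEND (typer g11, same night).  THE ONE-VS-TWO FORM (`orbit_exchange₂`, mirror `orbit_exchange₂'`): when the orbit at one of the two
slopes is compared with TWO present hybrids `H₂, H₃` and the other with one hybrid `H₁`, under the doubled bookkeeping
`e(P) + 2·e(Q) = e(H₁) + e(H₂) + e(H₃)` (and the same for heights), the affine function `W(P) − W(H₁) = W(H₂) + W(H₃) − 2·W(Q)` changes sign
between the slopes, so `e(P) < e(H₁)` (resp. `e(H₁) < e(P)` in the mirror).  This is the shape of the pair-carrier rules R3w / R3′w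
(`D` versus `C` through three transposition hybrids) and, with one weak comparison, of R2w / R2′w; arithmetic cores `affine_cross₂`,
`affine_cross₂'`.  [folklore]
-/

-- `Summit.ValiantsHypothesis.ValiantsHypothesis.…` is the tree's mandated single-conjunct layout (Sub = Summit).
set_option linter.dupNamespace false
set_option autoImplicit false

namespace Summit.ValiantsHypothesis.ValiantsHypothesis.Theorems.LacunarySymmetroidMatrixDescartes.TropicalCensus.Orbit

open Summit.ValiantsHypothesis.ValiantsHypothesis.Theorems.MatrixDescartes.Negative
open Summit.ValiantsHypothesis.ValiantsHypothesis.Theorems.LacunarySymmetroidMatrixDescartes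
open Summit.ValiantsHypothesis.ValiantsHypothesis.Theorems.LacunarySymmetroidMatrixDescartes.TropicalCensus
open scoped BigOperators

variable {m K : ℕ}

/-! ## The general two-point orbit exchange lemma -/

/-- **ORBIT EXCHANGE.**  `P` orbit-dominant at `θ₁`, `Q` orbit-dominant at `θ₂ > θ₁`; present hybrids `H₁ ∉ {P, Pᵀ}`, `H₂ ∉ {Q, Qᵀ}`
re-pairing the letters of `P` and `Q` (equal exponent sums, equal height sums) ⇒ `e(P) < e(H₁)`:
`∑ d(P-letters) < ∑ d(H₁-letters)`. [folklore] -/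
theorem orbit_exchange (d : Fin K → ℕ) (v ε : Fin m → Fin m → Fin K → ℤ) {θ₁ θ₂ : ℤ} (hθ : θ₁ < θ₂)
    (P Q H₁ H₂ : Equiv.Perm (Fin m) × (Fin m → Fin K))
    (hP : IsOrbitDominant d v ε θ₁ P) (hQ : IsOrbitDominant d v ε θ₂ Q)
    (h₁P : H₁ ≠ P) (h₁Pt : H₁ ≠ transposeTerm P) (hH₁ : termSign ε H₁ ≠ 0)
    (h₂Q : H₂ ≠ Q) (h₂Qt : H₂ ≠ transposeTerm Q) (hH₂ : termSign ε H₂ ≠ 0)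
    (ha : ∑ l, (d (P.2 l) : ℤ) + ∑ l, (d (Q.2 l) : ℤ) = ∑ l, (d (H₁.2 l) : ℤ) + ∑ l, (d (H₂.2 l) : ℤ))
    (hc : ∑ l, v (P.1 l) l (P.2 l) + ∑ l, v (Q.1 l) l (Q.2 l) =
      ∑ l, v (H₁.1 l) l (H₁.2 l) + ∑ l, v (H₂.1 l) l (H₂.2 l)) :
    ∑ l, (d (P.2 l) : ℤ) < ∑ l, (d (H₁.2 l) : ℤ) := by
  have c1 := hP.2 H₁ h₁P h₁Pt hH₁
  have c2 := hQ.2 H₂ h₂Q h₂Qt hH₂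
  simp only [tropWeight] at c1 c2
  exact affine_cross hθ ha hc c1 c2

/-- **ORBIT EXCHANGE, the `Q` side.**  Same hypotheses ⇒ `e(H₂) < e(Q)`: `∑ d(H₂-letters) < ∑ d(Q-letters)`. [folklore] -/
theorem orbit_exchange_right (d : Fin K → ℕ) (v ε : Fin m → Fin m → Fin K → ℤ) {θ₁ θ₂ : ℤ} (hθ : θ₁ < θ₂)
    (P Q H₁ H₂ : Equiv.Perm (Fin m) × (Fin m → Fin K))
    (hP : IsOrbitDominant d v ε θ₁ P) (hQ : IsOrbitDominant d v ε θ₂ Q)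
    (h₁P : H₁ ≠ P) (h₁Pt : H₁ ≠ transposeTerm P) (hH₁ : termSign ε H₁ ≠ 0)
    (h₂Q : H₂ ≠ Q) (h₂Qt : H₂ ≠ transposeTerm Q) (hH₂ : termSign ε H₂ ≠ 0)
    (ha : ∑ l, (d (P.2 l) : ℤ) + ∑ l, (d (Q.2 l) : ℤ) = ∑ l, (d (H₁.2 l) : ℤ) + ∑ l, (d (H₂.2 l) : ℤ))
    (hc : ∑ l, v (P.1 l) l (P.2 l) + ∑ l, v (Q.1 l) l (Q.2 l) =
      ∑ l, v (H₁.1 l) l (H₁.2 l) + ∑ l, v (H₂.1 l) l (H₂.2 l)) :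
    ∑ l, (d (H₂.2 l) : ℤ) < ∑ l, (d (Q.2 l) : ℤ) := by
  have h := orbit_exchange d v ε hθ P Q H₁ H₂ hP hQ h₁P h₁Pt hH₁ h₂Q h₂Qt hH₂ ha hc
  omega

/-! ## The D/T hybrid pair and its bookkeeping

For the identity carrier `D = (1, λ)` and a transposition carrier `T = (swap i j, μ)` the two hybrids are
`H_T := (swap i j, μ on {i,j}, λ elsewhere)` and `H_D := (1, λ on {i,j}, μ elsewhere)`; cell by cell `{D, T}` and `{H_T, H_D}` carry the
same letters, so the exponent sums and the height sums agree. -/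

/-- Exponent bookkeeping of the D/T hybrid pair. [folklore] -/
theorem sum_d_hybrid_DT (d : Fin K → ℕ) (i j : Fin m) (lam μ : Fin m → Fin K) :
    ∑ l, (d (lam l) : ℤ) + ∑ l, (d (μ l) : ℤ) =
      ∑ l, (d (if l = i ∨ l = j then μ l else lam l) : ℤ) + ∑ l, (d (if l = i ∨ l = j then lam l else μ l) : ℤ) := by
  rw [← Finset.sum_add_distrib, ← Finset.sum_add_distrib]
  refine Finset.sum_congr rfl fun l _ => ?_
  by_cases h : l = i ∨ l = j <;> simp [h, add_comm]

/-- Height bookkeeping of the D/T hybrid pair. [folklore] -/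
theorem sum_v_hybrid_DT (v : Fin m → Fin m → Fin K → ℤ) (i j : Fin m) (lam μ : Fin m → Fin K) :
    ∑ l, v ((1 : Equiv.Perm (Fin m)) l) l (lam l) + ∑ l, v ((Equiv.swap i j) l) l (μ l) =
      ∑ l, v ((Equiv.swap i j) l) l (if l = i ∨ l = j then μ l else lam l) +
        ∑ l, v ((1 : Equiv.Perm (Fin m)) l) l (if l = i ∨ l = j then lam l else μ l) := by
  rw [← Finset.sum_add_distrib, ← Finset.sum_add_distrib]
  refine Finset.sum_congr rfl fun l _ => ?_
  by_cases h : l = i ∨ l = j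
  · simp [h, add_comm]
  · push Not at h
    simp [h.1, h.2, Equiv.swap_apply_of_ne_of_ne h.1 h.2]

/-- A transposition carrier is not the identity carrier. -/
theorem swap_ne_one_perm {i j : Fin m} (hij : i ≠ j) : Equiv.swap i j ≠ (1 : Equiv.Perm (Fin m)) :=
  fun h => hij (Equiv.swap_eq_refl_iff.mp h)

/-- The transpose of an identity-carrier term has identity carrier. -/
theorem transposeTerm_one_fst (lam : Fin m → Fin K) :
    (transposeTerm ((1 : Equiv.Perm (Fin m)), lam)).1 = 1 := by
  simp [transposeTerm]

/-- The transpose of a transposition-carrier term has the same transposition carrier. -/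
theorem transposeTerm_swap_fst (i j : Fin m) (μ : Fin m → Fin K) :
    (transposeTerm (Equiv.swap i j, μ)).1 = Equiv.swap i j := by
  simp [transposeTerm, Equiv.swap_inv]

/-! ## Rules R1w and R1′w as instances -/

/-- **Rule R1′w** (transposition orbit at `θ₁`, identity orbit at `θ₂`): `(swap i j, μ)` orbit-dominant at `θ₁`, `(1, λ)` orbit-dominant
at `θ₂ > θ₁`, the two hybrids present ⇒ `∑ d(μ) < ∑ d(λ on {i,j}, μ elsewhere)`, i.e. `d(μ i) + d(μ j) < d(λ i) + d(λ j)`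
(`2·d b < d(λ i) + d(λ j)` for a cycle-constant transposition orbit, method memo §3 R1′w). [folklore] -/
theorem rule_R1w' (d : Fin K → ℕ) (v ε : Fin m → Fin m → Fin K → ℤ) (θ₁ θ₂ : ℤ) (hθ : θ₁ < θ₂)
    (i j : Fin m) (hij : i ≠ j) (lam μ : Fin m → Fin K)
    (hT : IsOrbitDominant d v ε θ₁ (Equiv.swap i j, μ)) (hD : IsOrbitDominant d v ε θ₂ (1, lam))
    (hH₁ : termSign ε ((1 : Equiv.Perm (Fin m)), fun l => if l = i ∨ l = j then lam l else μ l) ≠ 0)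
    (hH₂ : termSign ε (Equiv.swap i j, fun l => if l = i ∨ l = j then μ l else lam l) ≠ 0) :
    ∑ l, (d (μ l) : ℤ) < ∑ l, (d (if l = i ∨ l = j then lam l else μ l) : ℤ) := by
  have hsw := swap_ne_one_perm hij
  refine orbit_exchange d v ε hθ (Equiv.swap i j, μ) (1, lam)
    ((1 : Equiv.Perm (Fin m)), fun l => if l = i ∨ l = j then lam l else μ l)
    (Equiv.swap i j, fun l => if l = i ∨ l = j then μ l else lam l) hT hD
    (fun h => hsw (congrArg Prod.fst h).symm)
    (fun h => hsw (by rw [← transposeTerm_swap_fst i j μ]; exact (congrArg Prod.fst h).symm)) hH₁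
    (fun h => hsw (congrArg Prod.fst h))
    (fun h => hsw (by rw [← transposeTerm_one_fst (m := m) lam]; exact congrArg Prod.fst h)) hH₂ ?_ ?_
  · have := sum_d_hybrid_DT d i j lam μ
    simp only
    omega
  · have := sum_v_hybrid_DT v i j lam μ
    simp only
    omega

/-- **Rule R1w re-derived from `orbit_exchange`** (identity orbit at `θ₁`, transposition orbit at `θ₂` ⇒
`∑ d(λ) < ∑ d(μ on {i,j}, λ elsewhere)`): the same statement as p473280's `rule_R1w`, as a consistency check of the general lemma.
[folklore] -/
theorem rule_R1w_of_exchange (d : Fin K → ℕ) (v ε : Fin m → Fin m → Fin K → ℤ) (θ₁ θ₂ : ℤ) (hθ : θ₁ < θ₂)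
    (i j : Fin m) (hij : i ≠ j) (lam μ : Fin m → Fin K)
    (hD : IsOrbitDominant d v ε θ₁ (1, lam)) (hT : IsOrbitDominant d v ε θ₂ (Equiv.swap i j, μ))
    (hH₁ : termSign ε (Equiv.swap i j, fun l => if l = i ∨ l = j then μ l else lam l) ≠ 0)
    (hH₂ : termSign ε ((1 : Equiv.Perm (Fin m)), fun l => if l = i ∨ l = j then lam l else μ l) ≠ 0) :
    ∑ l, (d (lam l) : ℤ) < ∑ l, (d (if l = i ∨ l = j then μ l else lam l) : ℤ) := by
  have hsw := swap_ne_one_perm hij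
  refine orbit_exchange d v ε hθ (1, lam) (Equiv.swap i j, μ)
    (Equiv.swap i j, fun l => if l = i ∨ l = j then μ l else lam l)
    ((1 : Equiv.Perm (Fin m)), fun l => if l = i ∨ l = j then lam l else μ l) hD hT
    (fun h => hsw (congrArg Prod.fst h))
    (fun h => hsw (by rw [← transposeTerm_one_fst (m := m) lam]; exact congrArg Prod.fst h)) hH₁
    (fun h => hsw (congrArg Prod.fst h).symm)
    (fun h => hsw (by rw [← transposeTerm_swap_fst i j μ]; exact (congrArg Prod.fst h).symm)) hH₂ ?_ ?_
  · have := sum_d_hybrid_DT d i j lam μ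
    simp only
    omega
  · have := sum_v_hybrid_DT v i j lam μ
    simp only
    omega


/-! ## The one-vs-two form (for the pair-carrier rules) -/

/-- affine crossing, one comparison at `θ₁` and two at `θ₂` under doubled bookkeeping. [folklore] -/
theorem affine_cross₂ {θ₁ θ₂ a a' a₁ a₂ a₃ c c' c₁ c₂ c₃ : ℤ} (hθ : θ₁ < θ₂) (ha : a + 2 * a' = a₁ + a₂ + a₃)
    (hc : c + 2 * c' = c₁ + c₂ + c₃) (h1 : θ₁ * a₁ - c₁ < θ₁ * a - c) (h2 : θ₂ * a₂ - c₂ < θ₂ * a' - c')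
    (h3 : θ₂ * a₃ - c₃ < θ₂ * a' - c') : a < a₁ := by
  have e1 : a₂ + a₃ = a + 2 * a' - a₁ := by omega
  have e2 : c₂ + c₃ = c + 2 * c' - c₁ := by omega
  have hY : θ₂ * a - θ₂ * a₁ - c + c₁ < 0 := by
    have e3 : θ₂ * a₂ + θ₂ * a₃ = θ₂ * a + 2 * (θ₂ * a') - θ₂ * a₁ := by
      rw [← mul_add, e1]; ring
    linarith
  have hX : 0 < θ₁ * a - θ₁ * a₁ - c + c₁ := by linarith
  by_contra hcon
  push Not at hcon
  nlinarith [mul_nonneg (sub_nonneg.mpr hθ.le) (sub_nonneg.mpr hcon)]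

/-- affine crossing, two comparisons at `θ₁` and one at `θ₂` under doubled bookkeeping (the mirror). [folklore] -/
theorem affine_cross₂' {θ₁ θ₂ a a' a₁ a₂ a₃ c c' c₁ c₂ c₃ : ℤ} (hθ : θ₁ < θ₂) (ha : a + 2 * a' = a₁ + a₂ + a₃)
    (hc : c + 2 * c' = c₁ + c₂ + c₃) (h1 : θ₁ * a₂ - c₂ < θ₁ * a' - c') (h2 : θ₁ * a₃ - c₃ < θ₁ * a' - c')
    (h3 : θ₂ * a₁ - c₁ < θ₂ * a - c) : a₁ < a := by
  have e1 : a₂ + a₃ = a + 2 * a' - a₁ := by omega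
  have e2 : c₂ + c₃ = c + 2 * c' - c₁ := by omega
  have hY : θ₁ * a - θ₁ * a₁ - c + c₁ < 0 := by
    have e3 : θ₁ * a₂ + θ₁ * a₃ = θ₁ * a + 2 * (θ₁ * a') - θ₁ * a₁ := by
      rw [← mul_add, e1]; ring
    linarith
  have hX : 0 < θ₂ * a - θ₂ * a₁ - c + c₁ := by linarith
  by_contra hcon
  push Not at hcon
  nlinarith [mul_nonneg (sub_nonneg.mpr hθ.le) (sub_nonneg.mpr hcon)]

/-- **ORBIT EXCHANGE, one-vs-two.**  `P` orbit-dominant at `θ₁` with a present hybrid `H₁ ∉ {P, Pᵀ}`; `Q` orbit-dominant at `θ₂ > θ₁`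
with two present hybrids `H₂, H₃ ∉ {Q, Qᵀ}`; doubled bookkeeping `e(P) + 2 e(Q) = e(H₁) + e(H₂) + e(H₃)` and the same for the
height sums ⇒ `e(P) < e(H₁)`.  (Shape of R3w: `P = D(λ)`, `Q = C(c)`, `H₁ = T_p(c_p | λ_k)`, `H₂ = T_q(c_q | λ_j)`, `H₃ = T_r(c_r | λ_i)`.)
[folklore] -/
theorem orbit_exchange₂ (d : Fin K → ℕ) (v ε : Fin m → Fin m → Fin K → ℤ) {θ₁ θ₂ : ℤ} (hθ : θ₁ < θ₂)
    (P Q H₁ H₂ H₃ : Equiv.Perm (Fin m) × (Fin m → Fin K))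
    (hP : IsOrbitDominant d v ε θ₁ P) (hQ : IsOrbitDominant d v ε θ₂ Q)
    (h₁P : H₁ ≠ P) (h₁Pt : H₁ ≠ transposeTerm P) (hH₁ : termSign ε H₁ ≠ 0)
    (h₂Q : H₂ ≠ Q) (h₂Qt : H₂ ≠ transposeTerm Q) (hH₂ : termSign ε H₂ ≠ 0)
    (h₃Q : H₃ ≠ Q) (h₃Qt : H₃ ≠ transposeTerm Q) (hH₃ : termSign ε H₃ ≠ 0)
    (ha : ∑ l, (d (P.2 l) : ℤ) + 2 * ∑ l, (d (Q.2 l) : ℤ) =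
      ∑ l, (d (H₁.2 l) : ℤ) + ∑ l, (d (H₂.2 l) : ℤ) + ∑ l, (d (H₃.2 l) : ℤ))
    (hc : ∑ l, v (P.1 l) l (P.2 l) + 2 * ∑ l, v (Q.1 l) l (Q.2 l) =
      ∑ l, v (H₁.1 l) l (H₁.2 l) + ∑ l, v (H₂.1 l) l (H₂.2 l) + ∑ l, v (H₃.1 l) l (H₃.2 l)) :
    ∑ l, (d (P.2 l) : ℤ) < ∑ l, (d (H₁.2 l) : ℤ) := by
  have c1 := hP.2 H₁ h₁P h₁Pt hH₁
  have c2 := hQ.2 H₂ h₂Q h₂Qt hH₂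
  have c3 := hQ.2 H₃ h₃Q h₃Qt hH₃
  simp only [tropWeight] at c1 c2 c3
  exact affine_cross₂ hθ ha hc c1 c2 c3

/-- **ORBIT EXCHANGE, two-vs-one (the mirror).**  `Q` orbit-dominant at `θ₁` with two present hybrids `H₂, H₃ ∉ {Q, Qᵀ}`; `P`
orbit-dominant at `θ₂ > θ₁` with a present hybrid `H₁ ∉ {P, Pᵀ}`; the same doubled bookkeeping ⇒ `e(H₁) < e(P)`.  (Shape of R3′w:
`Q = C(c)` at `θ₁`, `P = D(λ)` at `θ₂`.) [folklore] -/
theorem orbit_exchange₂' (d : Fin K → ℕ) (v ε : Fin m → Fin m → Fin K → ℤ) {θ₁ θ₂ : ℤ} (hθ : θ₁ < θ₂)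
    (P Q H₁ H₂ H₃ : Equiv.Perm (Fin m) × (Fin m → Fin K))
    (hQ : IsOrbitDominant d v ε θ₁ Q) (hP : IsOrbitDominant d v ε θ₂ P)
    (h₁P : H₁ ≠ P) (h₁Pt : H₁ ≠ transposeTerm P) (hH₁ : termSign ε H₁ ≠ 0)
    (h₂Q : H₂ ≠ Q) (h₂Qt : H₂ ≠ transposeTerm Q) (hH₂ : termSign ε H₂ ≠ 0)
    (h₃Q : H₃ ≠ Q) (h₃Qt : H₃ ≠ transposeTerm Q) (hH₃ : termSign ε H₃ ≠ 0)
    (ha : ∑ l, (d (P.2 l) : ℤ) + 2 * ∑ l, (d (Q.2 l) : ℤ) =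
      ∑ l, (d (H₁.2 l) : ℤ) + ∑ l, (d (H₂.2 l) : ℤ) + ∑ l, (d (H₃.2 l) : ℤ))
    (hc : ∑ l, v (P.1 l) l (P.2 l) + 2 * ∑ l, v (Q.1 l) l (Q.2 l) =
      ∑ l, v (H₁.1 l) l (H₁.2 l) + ∑ l, v (H₂.1 l) l (H₂.2 l) + ∑ l, v (H₃.1 l) l (H₃.2 l)) :
    ∑ l, (d (H₁.2 l) : ℤ) < ∑ l, (d (P.2 l) : ℤ) := by
  have c1 := hQ.2 H₂ h₂Q h₂Qt hH₂
  have c2 := hQ.2 H₃ h₃Q h₃Qt hH₃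
  have c3 := hP.2 H₁ h₁P h₁Pt hH₁
  simp only [tropWeight] at c1 c2 c3
  exact affine_cross₂' hθ ha hc c1 c2 c3

end Summit.ValiantsHypothesis.ValiantsHypothesis.Theorems.LacunarySymmetroidMatrixDescartes.TropicalCensus.Orbit
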